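import Summits.QuantumFields.YangMills.Theorems.BalabanUVNodesN07KernelEntriesOfRecord
import Summits.QuantumFields.YangMills.Theorems.BalabanUVNodesKLCPrAtHierFrameParam
import HarnessLib

/-!
# BalabanUVNodes ∕ N07 — K0ᴬ WALL {W3} TYPED AS DISPLAYED ROWS: PT-B G1's SIX (KL-N) BINDERS FOR A COMPOSITE `S ∘ T` FROM THE (3.133) ENTRY ROWS OF `T` ({W2}) AND THE
# LOCALITY ROWS OF THE CURRENT READER `S` ({W3}) — letter-generic (n07-e's `T`, `S`), then THE ᵖʳ PIN INSTANCE `T := H₁^{pr}(U₀)`, `S := Δπ(U₀; G′, Q′)`: «{5} (KL-N)ᵖʳ ⇐ {W2} ∧ {W3}»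

Cell `ym-nodeO-ideate`, porter seat PT-A-1 (gen 12 = «the [15] desk», ★★★ director-ym №650 docket (B)); `--kind proof --supports stmt-QuantumFields-27238 --as helper` (two bookkeeping `def`s §2a ⇒ the gate
may queue it as definition kind); count-neutral.  [15] = [B11] = [Balaban1985Variational]; [B9] = [Balaban1985BackgroundPropagators]; [4] = [Balaban1984PropagatorsII].
SHAPE agreed with ★ PT-B g11 in one bus line before INTENT (nodeO STATUS 20:19:45Z: (q1) JET reading — values + ∇_{U₀}; (q2) (R) BLOCK-AGGREGATED; (q3) no basename∕ns clash; `hpos`∕`hQ` displayed).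

THE PRINT.  [15] p. 291: *«⟨A′, Δ_π HD(A′)⟩ = ⟨A′, (Δ_U + DRD*)HD(A′)⟩ (87) … Applying the inequalities (3.132) from [5], (55), (73) … we can estimate this functional derivative by
O(1)ε₁(Lʲη)⁻³ on Ω_j» (88)*; (72)–(73) p. 289 (the operator `R` of the current insertion and its exponential decay); [B9] (3.132)–(3.133) p. 422; [4] (2.61) p. 234 (row sum).
★ PT-B g11's K0ᴬ triage (nodeO STATUS 19:48:24Z) at the re-pinned pins ✓p831721 `…KLCPrAtHierFrameParam` §2∕§3: binder group {5} (KL-N)ᵖʳ (`hk′0 ∕ hNk ∕ hΘ′0 ∕ hΘ′ ∕ hN₁0 ∕ hN₁` = sup-column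
bounds of `ΔΠ_cur(U₀)·G′·Q′·H₁^{pr}δ`) = «WALL-L GIVEN {W2} … no tree reduction theorem yet (glue after {2})»; {W2} = [B9] Thm 3.12 (3.133) rows of `H₁^{pr}(U₀)` (XL, lane N07); {W3} = [15]
(72)–(73)∕(86)–(89) current-insertion locality (L; «unowned glue + content»).  THIS FILE is that glue, with {W3}'s content DISPLAYED as rows.

LOCATED.  n07-e's ✓`…N07KernelEntriesOfRecord` §5 ★★`klN_of_nEntryBounds` ALREADY yields the six (KL-N) binders for ANY `S ∘ T` — from ONE row about the COMPOSITE (`nEntry0 S T y″ y ≤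
B₀e^{−ρd}`, print's (130)); nothing in the tree splits that row into `T`'s (3.133) rows and `S`'s locality, and NO kernel∕locality lemma for `DeltaPiCurOfRecord` exists (tree theorems about it:
`_gaugeMode`, `_pair27_comm`, `_pairSum_comm`, `_herm`, `conjNeg3_…` only).

WHAT (node-00 = `∀ x, x ∈ Ω k`; standing range `k ≤ m + K`; `d` = `Site.tdist` of source sites; `Δ(y″)` = the fibre `blkOfBond⁻¹(y″)`; ns `…BalabanUVNodes.N07KLNOfLocalityRows`):
* §1 `exp_conv_le` — `Σ_{y″} e^{−σd(y₁,y″)}e^{−ρd(y″,y)} ≤ d(2(1+1∕m))^d·e^{−m·d(y₁,y)}`, `m := min σ ρ ∕ 2` (✓`B3Taylor310LocalRemainder.tdist_triangle` + ✓`rowSum_PBond_le`).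
* §2a `blockRow0 s₀ b′ y″ := Σ_{x∈Δ(y″)} s₀(b′,x)`, `blockRow1 s₁ b′ y″ := Σ_{p.1∈Δ(y″)} s₁(b′,p)` (two bookkeeping `def`s: the `if blkOfBond · = y″` is hidden ONCE so that displayed rows carry NO
  decidability instance — located live: a row stated with a bare `if` elaborates against whichever `DecidableEq (PBond …)` is in scope and then fails to unify across desks); `_nonneg`.
* §2 `opNorm_nColOp_le_of_locality`, `sum_s0_colOp_le`, `sum_s1_colOp1_le`, ★★ `nEntry0_le_of_localityRows`: {W3} ∧ {W2} ⟹ `nEntry0 S T y₃ y ≤ C_π·B₀·d(2(1+1∕m))^d·e^{−m·d(y₃,y)}`.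
  {W3} := (L) `‖(S A)(b′)‖ ≤ Σ_x s₀(b′,x)‖A(x)‖ + Σ_p s₁(b′,p)‖(∇_{U₀}A)(p)‖` for every (115)-jet `A` (`s₀, s₁ ≥ 0` fine majorants) ∧ (R) `blockRow0 s₀ b′ y″ + blockRow1 s₁ b′ y″ ≤
  C_π·e^{−σ·d(Δ⁻¹(b′), y″)}`; {W2} := the (3.133) PAIR VERBATIM as displayed by ★★★`prop4LetterH_of_entryBounds` (`entry0`, `entry1` rows at `(B₀, ρ)`) — so ONE displayed pair serves
  (ℓa-H)ᵖʳ {2}, (KL-H)ᵖʳ {3} (✓`klH_of_entryBounds`) AND (KL-N)ᵖʳ {5}.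
* §3 ★★★ `klN_of_localityRows_of_entryBounds` := §2 ∘ ✓`klN_of_nEntryBounds` — the six (KL-N) binders at `hk′ := ‖nColOp S T y b′‖`, `B₁ := C_π B₀ d(2(1+1∕m))^d`, `Θ′ := (L^d)^k·B₁·d(2(1+1∕m))^d`
  (NOT k-free — as n07-e's; G1 pairs it with (KL-C)'s `G ~ η^d`), `N₁ := B₁·d(2(1+1∕m))^d`.
* §4 ★★★ `klNPr_of_localityRows_of_entryBounds` — §3 AT THE PINS: `T := H1prOfRecordAtBg F N K k Ω U₀ 𝔥 levB a hpos hQ` (ANY frame datum `𝔥`: the SL pin `hierFrameDatumOfRecord`, the GL pin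
  `hierFrameGLDatumOfRecord`; `hpos`, `hQ` DISPLAYED), `S := DeltaPiCurOfRecord F N K k Ω U₀ Gp (QprimeOfRecord F N k U₀)` (def-Y's W₇ current reader): conclusions LITERALLY the types of
  `hk'0 ∕ hNk ∕ hΘ'0 ∕ hΘ' ∕ hN₁0 ∕ hN₁` of ✓`prop4UniformPrAtRecord_node00_of_prop5Clause_hierFrame{,GL}Rec` — KERNEL-WITNESSED in scratch (NOT filed): a copy of the GL pin's signature with the
  (KL-N)ᵖʳ group replaced by {W2} ∧ {W3} closes by `obtain ⟨…⟩ := klNPr_…; exact prop4UniformPrAtRecord_node00_of_prop5Clause_hierFrameGLRec … hk'0 hNk hΘ'0 hΘ' hN₁0 hN₁ hJ` (rc 0; the pin's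
  `[DecidableEq (PBond …)]` binder resolved at the call site to the tree's global instance, as for n07-e ↔ G4 — consumers must not shadow it locally).

HONEST FRAMING.  BY-NAME REDUCTION + finite-sum bookkeeping (operator norms, a fibrewise exchange of sums, the triangle inequality, one geometric row sum); {W2} and {W3} are DISPLAYED
per-member hypotheses INHABITED NOWHERE — nothing of [B9] Thm 3.12 ∕ (3.132)–(3.133), of [15] (72)–(73)∕(86)–(89) (the decay of `R`, the locality of `Δ_π`), of Prop. 4 or of [B7] Prop. 5 is
proved here; k-uniformity of `C_π, σ, B₀, ρ` is the suppliers' problem, not asserted; (KL-C), (ℓd) and Prop. 4's assembly stay PT-B's; K0ᴬ ⟨stmt-QuantumFields-27238⟩ NOT closed (0∕2);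
⟨27930⟩ 1∕7 · NODE O 0∕1 · COUNT 8∕28 · K 1∕4 UNMOVED; one finite `𝕋⁴_{L^K}` programme at fixed ε — NOT continuum ∕ OS ∕ Clay; **the Yang–Mills mass gap is NOT proved by any of this.**
No `sorry`, no `instance`, no `notation`, no `set_option`; standard axioms.
-/

noncomputable section
open scoped Matrix Matrix.Norms.L2Operator InnerProductSpace ComplexConjugate BigOperators
namespace Summit.QuantumFields.YangMills.BalabanUVNodes.N07KLNOfLocalityRows

open Literature.MathematicalPhysics.QuantumFieldTheory.Balaban1983to89
open Literature.MathematicalPhysics.QuantumFieldTheory.Balaban1983to89.Node00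
open T4Continuum (T4Family)
open B9SectCLatticeCarrier (Bond)
open B11Eq115Space (NegSup NegSize Space115 JetSup levWeight levWeight_apply)
open B11Eq111FrakG (nabla115)
open B11Eq103H1Complex (SiteL2K)
open B11KernelDictionary (fsup le_fsup fsup_nonneg fsup_le)
open Summit.QuantumFields.YangMills.BalabanUVNodes.N07Prop4LetterHOfThm312 (singleBIdx singleBIdx_apply blkOfBond rowSum_PBond_le tdist_comm_rec)
open Summit.QuantumFields.YangMills.BalabanUVNodes.N07KLHOfThm312 (sum_over_blocks_le levWeight_bondLevLit_eq_one_pow)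
open Summit.QuantumFields.YangMills.BalabanUVNodes.N07KernelEntriesOfRecord (colOp colOp1 colOp_apply colOp1_apply entry0 entry1 opNorm_colOp_le_entry0
  opNorm_colOp1_le_entry1 nColOp nColOp_apply nEntry0 opNorm_nColOp_le_nEntry0 klN_of_nEntryBounds)

variable (F : T4Family) (N : ℕ) (K k : ℕ) (Ω : ℕ → Set (Site (F.P K) 0)) (U₀ : GaugeField (F.P K) 0 (SU N)) (levB : PBond (F.P K) k → ℕ)
variable [Fact (0 < (F.L : ℝ))] [Fact (0 < (F.P K).eta k)]
variable (T : NegSize (F.L : ℝ) ((F.P K).eta k) levB 0 (Matrix (Fin N) (Fin N) ℂ) →L[ℂ] Space115Lit F N K k Ω U₀)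
variable (S : Space115Lit F N K k Ω U₀ →L[ℂ] NegSizeLit F N K k Ω 3)

/-! ## §1 The convolution of two exponential block rows -/

omit [Fact (0 < (F.L : ℝ))] [Fact (0 < (F.P K).eta k)] in
/-- **CONVOLUTION OF TWO EXPONENTIAL ROWS ON THE k-LATTICE**: `Σ_{y″} e^{−σ d(y₁,y″)} e^{−ρ d(y″,y)} ≤ d(2(1+1∕m))^d · e^{−m d(y₁,y)}`, `m := min σ ρ ∕ 2` — the triangle
inequality of the torus distance and the (2.61) row sum. [cite: Balaban1984PropagatorsII, (2.61) p.234; Balaban1985Variational, (88) p.291 (bookkeeping)] -/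
theorem exp_conv_le {σ ρ : ℝ} (hσ : 0 < σ) (hρ : 0 < ρ) (y₁ y : PBond (F.P K) k) :
    ∑ y'' : PBond (F.P K) k, Real.exp (-(σ * (Site.tdist y₁.src y''.src : ℝ))) * Real.exp (-(ρ * (Site.tdist y''.src y.src : ℝ))) ≤
      ((F.P K).d * (2 * (1 + 1 / (min σ ρ / 2))) ^ (F.P K).d) * Real.exp (-(min σ ρ / 2 * (Site.tdist y₁.src y.src : ℝ))) := by
  have hm : 0 < min σ ρ / 2 := by positivity
  have hterm : ∀ y'' : PBond (F.P K) k,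
      Real.exp (-(σ * (Site.tdist y₁.src y''.src : ℝ))) * Real.exp (-(ρ * (Site.tdist y''.src y.src : ℝ))) ≤
        Real.exp (-(min σ ρ / 2 * (Site.tdist y₁.src y.src : ℝ))) * Real.exp (-(min σ ρ / 2 * (Site.tdist y₁.src y''.src : ℝ))) := by
    intro y''
    rw [← Real.exp_add, ← Real.exp_add]
    apply Real.exp_le_exp.mpr
    have htri : (Site.tdist y₁.src y.src : ℝ) ≤ (Site.tdist y₁.src y''.src : ℝ) + (Site.tdist y''.src y.src : ℝ) := by
      exact_mod_cast B3Taylor310LocalRemainder.tdist_triangle y₁.src y''.src y.src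
    have h1 : min σ ρ / 2 ≤ σ / 2 := by gcongr; exact min_le_left _ _
    have h2 : min σ ρ / 2 ≤ ρ / 2 := by gcongr; exact min_le_right _ _
    have d1 : (0 : ℝ) ≤ (Site.tdist y₁.src y''.src : ℝ) := Nat.cast_nonneg _
    have d2 : (0 : ℝ) ≤ (Site.tdist y''.src y.src : ℝ) := Nat.cast_nonneg _
    nlinarith [mul_nonneg hm.le d1, mul_nonneg hm.le d2]
  calc ∑ y'' : PBond (F.P K) k, Real.exp (-(σ * (Site.tdist y₁.src y''.src : ℝ))) * Real.exp (-(ρ * (Site.tdist y''.src y.src : ℝ)))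
      ≤ ∑ y'' : PBond (F.P K) k, Real.exp (-(min σ ρ / 2 * (Site.tdist y₁.src y.src : ℝ))) * Real.exp (-(min σ ρ / 2 * (Site.tdist y₁.src y''.src : ℝ))) :=
        Finset.sum_le_sum fun y'' _ => hterm y''
    _ = Real.exp (-(min σ ρ / 2 * (Site.tdist y₁.src y.src : ℝ))) * ∑ y'' : PBond (F.P K) k, Real.exp (-(min σ ρ / 2 * (Site.tdist y₁.src y''.src : ℝ))) := by
        rw [Finset.mul_sum]
    _ ≤ Real.exp (-(min σ ρ / 2 * (Site.tdist y₁.src y.src : ℝ))) * ((F.P K).d * (2 * (1 + 1 / (min σ ρ / 2))) ^ (F.P K).d) :=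
        mul_le_mul_of_nonneg_left (rowSum_PBond_le F K k y₁ hm) (Real.exp_nonneg _)
    _ = _ := mul_comm _ _

/-! ## §2a The block-aggregated rows of a fine kernel majorant (instance-free display) -/

open Classical in
/-- **`Σ_{x ∈ Δ(y″)} s₀(b′, x)`** — the block-aggregated row of a fine value-majorant `s₀` of a current reader (the `if` is hidden here once, so displayed rows carry no
decidability instance). [cite: Balaban1985Variational, (72)–(73) p.289, (88) p.291 (bookkeeping)] -/
def blockRow0 (s0 : Bond (F.P K).d (fun _ => (F.P K).sitesPerDir 0) → Bond (F.P K).d (fun _ => (F.P K).sitesPerDir 0) → ℝ) (b' : Bond (F.P K).d (fun _ => (F.P K).sitesPerDir 0)) (y'' : PBond (F.P K) k) : ℝ :=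
  ∑ x : Bond (F.P K).d (fun _ => (F.P K).sitesPerDir 0), if blkOfBond F K k x = y'' then s0 b' x else 0

open Classical in
/-- **`Σ_{p.1 ∈ Δ(y″)} s₁(b′, p)`** — the block-aggregated row of a fine ∇-majorant `s₁`. [cite: Balaban1985Variational, (72)–(73) p.289, (88) p.291 (bookkeeping)] -/
def blockRow1 (s1 : Bond (F.P K).d (fun _ => (F.P K).sitesPerDir 0) → Bond (F.P K).d (fun _ => (F.P K).sitesPerDir 0) × Fin (F.P K).d → ℝ) (b' : Bond (F.P K).d (fun _ => (F.P K).sitesPerDir 0)) (y'' : PBond (F.P K) k) : ℝ :=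
  ∑ p : Bond (F.P K).d (fun _ => (F.P K).sitesPerDir 0) × Fin (F.P K).d, if blkOfBond F K k p.1 = y'' then s1 b' p else 0

omit [Fact (0 < (F.L : ℝ))] [Fact (0 < (F.P K).eta k)] in
/-- `0 ≤ blockRow0` for a non-negative majorant. [cite: Balaban1985Variational, (88) p.291 (bookkeeping)] -/
theorem blockRow0_nonneg {s0 : Bond (F.P K).d (fun _ => (F.P K).sitesPerDir 0) → Bond (F.P K).d (fun _ => (F.P K).sitesPerDir 0) → ℝ} (hs0 : ∀ b' x, 0 ≤ s0 b' x) (b' : Bond (F.P K).d (fun _ => (F.P K).sitesPerDir 0)) (y'' : PBond (F.P K) k) :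
    0 ≤ blockRow0 F K k s0 b' y'' := by
  unfold blockRow0
  exact Finset.sum_nonneg fun x _ => by split_ifs; exacts [hs0 b' x, le_rfl]

omit [Fact (0 < (F.L : ℝ))] [Fact (0 < (F.P K).eta k)] in
/-- `0 ≤ blockRow1` for a non-negative majorant. [cite: Balaban1985Variational, (88) p.291 (bookkeeping)] -/
theorem blockRow1_nonneg {s1 : Bond (F.P K).d (fun _ => (F.P K).sitesPerDir 0) → Bond (F.P K).d (fun _ => (F.P K).sitesPerDir 0) × Fin (F.P K).d → ℝ} (hs1 : ∀ b' p, 0 ≤ s1 b' p) (b' : Bond (F.P K).d (fun _ => (F.P K).sitesPerDir 0)) (y'' : PBond (F.P K) k) :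
    0 ≤ blockRow1 F K k s1 b' y'' := by
  unfold blockRow1
  exact Finset.sum_nonneg fun p _ => by split_ifs; exacts [hs1 b' p, le_rfl]

/-! ## §2 The composite's (130)-shape entry from {W2} ∧ {W3} -/

/-- **THE FINE COLUMN OF `S ∘ T` READ THROUGH `S`'s LOCALITY MAJORANTS**: `‖nColOp S T y b′‖ ≤ Σ_x s₀(b′,x)‖colOp T y x‖ + Σ_p s₁(b′,p)‖colOp1 T y p‖`.
[cite: Balaban1985Variational, (87)–(88) p.291, (72)–(73) p.289 (bookkeeping)] -/
theorem opNorm_nColOp_le_of_locality {s0 : Bond (F.P K).d (fun _ => (F.P K).sitesPerDir 0) → Bond (F.P K).d (fun _ => (F.P K).sitesPerDir 0) → ℝ}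
    {s1 : Bond (F.P K).d (fun _ => (F.P K).sitesPerDir 0) → Bond (F.P K).d (fun _ => (F.P K).sitesPerDir 0) × Fin (F.P K).d → ℝ}
    (hs0 : ∀ b' x, 0 ≤ s0 b' x) (hs1 : ∀ b' p, 0 ≤ s1 b' p)
    (hS : ∀ (A : Space115Lit F N K k Ω U₀) (b' : Bond (F.P K).d (fun _ => (F.P K).sitesPerDir 0)),
      ‖NegSup.equiv (levWeight (F.L : ℝ) ((F.P K).eta k) (bondLevLit F Ω k) 3) (Matrix (Fin N) (Fin N) ℂ) (S A) b'‖ ≤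
        ∑ x : Bond (F.P K).d (fun _ => (F.P K).sitesPerDir 0), s0 b' x * ‖JetSup.equiv _ _ _ A x‖ +
        ∑ p : Bond (F.P K).d (fun _ => (F.P K).sitesPerDir 0) × Fin (F.P K).d, s1 b' p * ‖(nabla115 ((F.P K).eta k) (unitsOfRecord F N U₀)) (JetSup.equiv _ _ _ A) p‖)
    (y : PBond (F.P K) k) (b' : Bond (F.P K).d (fun _ => (F.P K).sitesPerDir 0)) :
    ‖nColOp F N K k Ω U₀ levB T S y b'‖ ≤
      ∑ x : Bond (F.P K).d (fun _ => (F.P K).sitesPerDir 0), s0 b' x * ‖colOp F N K k Ω U₀ levB T y x‖ +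
      ∑ p : Bond (F.P K).d (fun _ => (F.P K).sitesPerDir 0) × Fin (F.P K).d, s1 b' p * ‖colOp1 F N K k Ω U₀ levB T y p‖ := by
  refine ContinuousLinearMap.opNorm_le_bound _ (add_nonneg (Finset.sum_nonneg fun x _ => mul_nonneg (hs0 b' x) (ContinuousLinearMap.opNorm_nonneg _))
    (Finset.sum_nonneg fun p _ => mul_nonneg (hs1 b' p) (ContinuousLinearMap.opNorm_nonneg _))) fun Z => ?_
  rw [nColOp_apply]
  refine (hS _ b').trans ?_
  rw [add_mul, Finset.sum_mul, Finset.sum_mul]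
  refine add_le_add (Finset.sum_le_sum fun x _ => ?_) (Finset.sum_le_sum fun p _ => ?_)
  · rw [mul_assoc]
    refine mul_le_mul_of_nonneg_left ?_ (hs0 b' x)
    have := ContinuousLinearMap.le_opNorm (colOp F N K k Ω U₀ levB T y x) Z
    rw [colOp_apply] at this
    exact this
  · rw [mul_assoc]
    refine mul_le_mul_of_nonneg_left ?_ (hs1 b' p)
    have := ContinuousLinearMap.le_opNorm (colOp1 F N K k Ω U₀ levB T y p) Z
    rw [colOp1_apply] at this
    exact this

/-- Fiberwise bookkeeping for the value majorant: `Σ_x s₀(b′,x)‖colOp T y x‖ ≤ Σ_{y″} (Σ_{x∈Δ(y″)} s₀(b′,x))·entry0 T y″ y`. [cite: Balaban1985BackgroundPropagators, (3.133) p.422 (bookkeeping)] -/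
theorem sum_s0_colOp_le {s0 : Bond (F.P K).d (fun _ => (F.P K).sitesPerDir 0) → Bond (F.P K).d (fun _ => (F.P K).sitesPerDir 0) → ℝ} (hs0 : ∀ b' x, 0 ≤ s0 b' x) (y : PBond (F.P K) k) (b' : Bond (F.P K).d (fun _ => (F.P K).sitesPerDir 0)) :
    ∑ x : Bond (F.P K).d (fun _ => (F.P K).sitesPerDir 0), s0 b' x * ‖colOp F N K k Ω U₀ levB T y x‖ ≤
      ∑ y'' : PBond (F.P K) k, blockRow0 F K k s0 b' y'' * entry0 F N K k Ω U₀ levB T y'' y := by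
  classical
  unfold blockRow0
  calc ∑ x : Bond (F.P K).d (fun _ => (F.P K).sitesPerDir 0), s0 b' x * ‖colOp F N K k Ω U₀ levB T y x‖
      ≤ ∑ x : Bond (F.P K).d (fun _ => (F.P K).sitesPerDir 0), s0 b' x * entry0 F N K k Ω U₀ levB T (blkOfBond F K k x) y :=
        Finset.sum_le_sum fun x _ => mul_le_mul_of_nonneg_left (opNorm_colOp_le_entry0 F N K k Ω U₀ levB T y x) (hs0 b' x)
    _ = ∑ x : Bond (F.P K).d (fun _ => (F.P K).sitesPerDir 0), ∑ y'' : PBond (F.P K) k, (if blkOfBond F K k x = y'' then s0 b' x else 0) * entry0 F N K k Ω U₀ levB T y'' y := by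
        refine Finset.sum_congr rfl fun x _ => ?_
        simp only [ite_mul, zero_mul, Finset.sum_ite_eq, Finset.mem_univ, if_true]
    _ = ∑ y'' : PBond (F.P K) k, ∑ x : Bond (F.P K).d (fun _ => (F.P K).sitesPerDir 0), (if blkOfBond F K k x = y'' then s0 b' x else 0) * entry0 F N K k Ω U₀ levB T y'' y := Finset.sum_comm
    _ = _ := Finset.sum_congr rfl fun y'' _ => (Finset.sum_mul _ _ _).symm

/-- Fiberwise bookkeeping for the ∇ majorant: `Σ_p s₁(b′,p)‖colOp1 T y p‖ ≤ Σ_{y″} (Σ_{p.1∈Δ(y″)} s₁(b′,p))·entry1 T y″ y`. [cite: Balaban1985BackgroundPropagators, (3.133) p.422 (bookkeeping)] -/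
theorem sum_s1_colOp1_le {s1 : Bond (F.P K).d (fun _ => (F.P K).sitesPerDir 0) → Bond (F.P K).d (fun _ => (F.P K).sitesPerDir 0) × Fin (F.P K).d → ℝ} (hs1 : ∀ b' p, 0 ≤ s1 b' p) (y : PBond (F.P K) k) (b' : Bond (F.P K).d (fun _ => (F.P K).sitesPerDir 0)) :
    ∑ p : Bond (F.P K).d (fun _ => (F.P K).sitesPerDir 0) × Fin (F.P K).d, s1 b' p * ‖colOp1 F N K k Ω U₀ levB T y p‖ ≤
      ∑ y'' : PBond (F.P K) k, blockRow1 F K k s1 b' y'' * entry1 F N K k Ω U₀ levB T y'' y := by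
  classical
  unfold blockRow1
  calc ∑ p : Bond (F.P K).d (fun _ => (F.P K).sitesPerDir 0) × Fin (F.P K).d, s1 b' p * ‖colOp1 F N K k Ω U₀ levB T y p‖
      ≤ ∑ p : Bond (F.P K).d (fun _ => (F.P K).sitesPerDir 0) × Fin (F.P K).d, s1 b' p * entry1 F N K k Ω U₀ levB T (blkOfBond F K k p.1) y :=
        Finset.sum_le_sum fun p _ => mul_le_mul_of_nonneg_left (opNorm_colOp1_le_entry1 F N K k Ω U₀ levB T y p) (hs1 b' p)
    _ = ∑ p : Bond (F.P K).d (fun _ => (F.P K).sitesPerDir 0) × Fin (F.P K).d, ∑ y'' : PBond (F.P K) k, (if blkOfBond F K k p.1 = y'' then s1 b' p else 0) * entry1 F N K k Ω U₀ levB T y'' y := by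
        refine Finset.sum_congr rfl fun p _ => ?_
        simp only [ite_mul, zero_mul, Finset.sum_ite_eq, Finset.mem_univ, if_true]
    _ = ∑ y'' : PBond (F.P K) k, ∑ p : Bond (F.P K).d (fun _ => (F.P K).sitesPerDir 0) × Fin (F.P K).d, (if blkOfBond F K k p.1 = y'' then s1 b' p else 0) * entry1 F N K k Ω U₀ levB T y'' y := Finset.sum_comm
    _ = _ := Finset.sum_congr rfl fun y'' _ => (Finset.sum_mul _ _ _).symm

/-- ★★ **THE (130)-SHAPE ENTRY OF `S ∘ T` FROM {W2} ∧ {W3}**: if `S` is LOCAL with majorants `s₀, s₁` ((L): `‖(SA)(b′)‖ ≤ Σ_x s₀(b′,x)|A(x)| + Σ_p s₁(b′,p)|(∇_{U₀}A)(p)|`) whose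
block-aggregated rows decay ((R): `Σ_{x∈Δ(y″)} s₀(b′,x) + Σ_{p.1∈Δ(y″)} s₁(b′,p) ≤ C_π e^{−σ d(Δ⁻¹(b′), y″)}`), and `T` has the (3.133) entry rows `entryₙ T y″ y ≤ B₀e^{−ρ d(y″,y)}` (n = 0, 1),
then `sup_{b′∈Δ(y₃)} ‖(S∘T)(b′, y)‖ ≤ C_π B₀ · d(2(1+1∕m))^d · e^{−m d(y₃,y)}`, `m := min σ ρ ∕ 2`.  Print: (87)–(88) «Δ_π H = (Δ_U + DRD*)H … applying (3.132), (55), (73)».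
Bookkeeping over the displayed rows. [cite: Balaban1985Variational, (87)–(88) p.291, (72)–(73) p.289, (130) p.298; Balaban1985BackgroundPropagators, (3.132)–(3.133) p.422; Balaban1984PropagatorsII, (2.61) p.234] -/
theorem nEntry0_le_of_localityRows {s0 : Bond (F.P K).d (fun _ => (F.P K).sitesPerDir 0) → Bond (F.P K).d (fun _ => (F.P K).sitesPerDir 0) → ℝ} {s1 : Bond (F.P K).d (fun _ => (F.P K).sitesPerDir 0) → Bond (F.P K).d (fun _ => (F.P K).sitesPerDir 0) × Fin (F.P K).d → ℝ} (hs0 : ∀ b' x, 0 ≤ s0 b' x) (hs1 : ∀ b' p, 0 ≤ s1 b' p)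
    (hS : ∀ (A : Space115Lit F N K k Ω U₀) (b' : Bond (F.P K).d (fun _ => (F.P K).sitesPerDir 0)),
      ‖NegSup.equiv (levWeight (F.L : ℝ) ((F.P K).eta k) (bondLevLit F Ω k) 3) (Matrix (Fin N) (Fin N) ℂ) (S A) b'‖ ≤
        ∑ x : Bond (F.P K).d (fun _ => (F.P K).sitesPerDir 0), s0 b' x * ‖JetSup.equiv _ _ _ A x‖ +
        ∑ p : Bond (F.P K).d (fun _ => (F.P K).sitesPerDir 0) × Fin (F.P K).d, s1 b' p * ‖(nabla115 ((F.P K).eta k) (unitsOfRecord F N U₀)) (JetSup.equiv _ _ _ A) p‖)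
    {Cπ σ : ℝ} (hCπ : 0 ≤ Cπ) (hσ : 0 < σ)
    (hR : ∀ (b' : Bond (F.P K).d (fun _ => (F.P K).sitesPerDir 0)) (y'' : PBond (F.P K) k),
      blockRow0 F K k s0 b' y'' + blockRow1 F K k s1 b' y'' ≤
        Cπ * Real.exp (-(σ * (Site.tdist (blkOfBond F K k b').src y''.src : ℝ))))
    {B₀ ρ : ℝ} (hB₀ : 0 ≤ B₀) (hρ : 0 < ρ)
    (h0 : ∀ y'' y : PBond (F.P K) k, entry0 F N K k Ω U₀ levB T y'' y ≤ B₀ * Real.exp (-(ρ * (Site.tdist y''.src y.src : ℝ))))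
    (h1 : ∀ y'' y : PBond (F.P K) k, entry1 F N K k Ω U₀ levB T y'' y ≤ B₀ * Real.exp (-(ρ * (Site.tdist y''.src y.src : ℝ))))
    (y₃ y : PBond (F.P K) k) :
    nEntry0 F N K k Ω U₀ levB T S y₃ y ≤
      Cπ * B₀ * ((F.P K).d * (2 * (1 + 1 / (min σ ρ / 2))) ^ (F.P K).d) * Real.exp (-(min σ ρ / 2 * (Site.tdist y₃.src y.src : ℝ))) := by
  classical
  have hm : 0 < min σ ρ / 2 := by positivity
  have hι0 : ∀ (b' : Bond (F.P K).d (fun _ => (F.P K).sitesPerDir 0)) (y'' : PBond (F.P K) k), 0 ≤ blockRow0 F K k s0 b' y'' := blockRow0_nonneg F K k hs0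
  have hι1 : ∀ (b' : Bond (F.P K).d (fun _ => (F.P K).sitesPerDir 0)) (y'' : PBond (F.P K) k), 0 ≤ blockRow1 F K k s1 b' y'' := blockRow1_nonneg F K k hs1
  unfold nEntry0
  refine fsup_le (by positivity) fun b' => ?_
  split_ifs with hb
  · calc ‖nColOp F N K k Ω U₀ levB T S y b'‖
        ≤ ∑ x : Bond (F.P K).d (fun _ => (F.P K).sitesPerDir 0), s0 b' x * ‖colOp F N K k Ω U₀ levB T y x‖ + ∑ p : Bond (F.P K).d (fun _ => (F.P K).sitesPerDir 0) × Fin (F.P K).d, s1 b' p * ‖colOp1 F N K k Ω U₀ levB T y p‖ :=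
          opNorm_nColOp_le_of_locality F N K k Ω U₀ levB T S hs0 hs1 hS y b'
      _ ≤ ∑ y'' : PBond (F.P K) k, blockRow0 F K k s0 b' y'' * entry0 F N K k Ω U₀ levB T y'' y +
          ∑ y'' : PBond (F.P K) k, blockRow1 F K k s1 b' y'' * entry1 F N K k Ω U₀ levB T y'' y :=
          add_le_add (sum_s0_colOp_le F N K k Ω U₀ levB T hs0 y b') (sum_s1_colOp1_le F N K k Ω U₀ levB T hs1 y b')
      _ ≤ ∑ y'' : PBond (F.P K) k, blockRow0 F K k s0 b' y'' * (B₀ * Real.exp (-(ρ * (Site.tdist y''.src y.src : ℝ)))) +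
          ∑ y'' : PBond (F.P K) k, blockRow1 F K k s1 b' y'' * (B₀ * Real.exp (-(ρ * (Site.tdist y''.src y.src : ℝ)))) :=
          add_le_add (Finset.sum_le_sum fun y'' _ => mul_le_mul_of_nonneg_left (h0 y'' y) (hι0 b' y''))
            (Finset.sum_le_sum fun y'' _ => mul_le_mul_of_nonneg_left (h1 y'' y) (hι1 b' y''))
      _ = ∑ y'' : PBond (F.P K) k, (blockRow0 F K k s0 b' y'' +
            blockRow1 F K k s1 b' y'') * (B₀ * Real.exp (-(ρ * (Site.tdist y''.src y.src : ℝ)))) := by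
          rw [← Finset.sum_add_distrib]
          exact Finset.sum_congr rfl fun y'' _ => (add_mul _ _ _).symm
      _ ≤ ∑ y'' : PBond (F.P K) k, (Cπ * Real.exp (-(σ * (Site.tdist (blkOfBond F K k b').src y''.src : ℝ)))) * (B₀ * Real.exp (-(ρ * (Site.tdist y''.src y.src : ℝ)))) :=
          Finset.sum_le_sum fun y'' _ => mul_le_mul_of_nonneg_right (hR b' y'') (mul_nonneg hB₀ (Real.exp_nonneg _))
      _ = Cπ * B₀ * ∑ y'' : PBond (F.P K) k, Real.exp (-(σ * (Site.tdist y₃.src y''.src : ℝ))) * Real.exp (-(ρ * (Site.tdist y''.src y.src : ℝ))) := by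
          rw [hb, Finset.mul_sum]
          exact Finset.sum_congr rfl fun y'' _ => by ring
      _ ≤ Cπ * B₀ * (((F.P K).d * (2 * (1 + 1 / (min σ ρ / 2))) ^ (F.P K).d) * Real.exp (-(min σ ρ / 2 * (Site.tdist y₃.src y.src : ℝ)))) :=
          mul_le_mul_of_nonneg_left (exp_conv_le F K k hσ hρ y₃ y) (mul_nonneg hCπ hB₀)
      _ = _ := by ring
  · positivity


/-! ## §3 ★★★ (KL-N) for `S ∘ T` from {W2} ∧ {W3} -/

/-- ★★★ **PT-B G1's SIX (KL-N) BINDERS FOR `S ∘ T` FROM THE (3.133) ENTRY ROWS OF `T` ({W2}) AND THE LOCALITY ROWS OF `S` ({W3})** (node-00 `∀ x, x ∈ Ω k`, `k ≤ m + K`):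
§2 composed with n07-e's ✓`klN_of_nEntryBounds` — `hk′(b′, y) := ‖nColOp S T y b′‖_op`, `Θ′ := (L^d)^k · B₁ · d(2(1+1∕m))^d`, `N₁ := B₁ · d(2(1+1∕m))^d` with `m := min σ ρ ∕ 2`,
`B₁ := C_π B₀ d(2(1+1∕m))^d`.  So ONE displayed (3.133) pair `(h0, h1)` serves (ℓa-H) (✓`prop4LetterH_of_entryBounds`), (KL-H) (✓`klH_of_entryBounds`) AND (KL-N) (here, given {W3}).
Bookkeeping over displayed rows; nothing of [B9]∕[B11] proved. [cite: Balaban1985Variational, (87)–(88) p.291, (72)–(73) p.289, (130) p.298; Balaban1985BackgroundPropagators, (3.132)–(3.133) p.422; Balaban1984PropagatorsII, (2.61) p.234] -/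
theorem klN_of_localityRows_of_entryBounds (hΩ : ∀ x, x ∈ Ω k) (hk : k ≤ (F.P K).m + (F.P K).K)
    {s0 : Bond (F.P K).d (fun _ => (F.P K).sitesPerDir 0) → Bond (F.P K).d (fun _ => (F.P K).sitesPerDir 0) → ℝ} {s1 : Bond (F.P K).d (fun _ => (F.P K).sitesPerDir 0) → Bond (F.P K).d (fun _ => (F.P K).sitesPerDir 0) × Fin (F.P K).d → ℝ} (hs0 : ∀ b' x, 0 ≤ s0 b' x) (hs1 : ∀ b' p, 0 ≤ s1 b' p)
    (hS : ∀ (A : Space115Lit F N K k Ω U₀) (b' : Bond (F.P K).d (fun _ => (F.P K).sitesPerDir 0)),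
      ‖NegSup.equiv (levWeight (F.L : ℝ) ((F.P K).eta k) (bondLevLit F Ω k) 3) (Matrix (Fin N) (Fin N) ℂ) (S A) b'‖ ≤
        ∑ x : Bond (F.P K).d (fun _ => (F.P K).sitesPerDir 0), s0 b' x * ‖JetSup.equiv _ _ _ A x‖ +
        ∑ p : Bond (F.P K).d (fun _ => (F.P K).sitesPerDir 0) × Fin (F.P K).d, s1 b' p * ‖(nabla115 ((F.P K).eta k) (unitsOfRecord F N U₀)) (JetSup.equiv _ _ _ A) p‖)
    {Cπ σ : ℝ} (hCπ : 0 ≤ Cπ) (hσ : 0 < σ)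
    (hR : ∀ (b' : Bond (F.P K).d (fun _ => (F.P K).sitesPerDir 0)) (y'' : PBond (F.P K) k),
      blockRow0 F K k s0 b' y'' + blockRow1 F K k s1 b' y'' ≤
        Cπ * Real.exp (-(σ * (Site.tdist (blkOfBond F K k b').src y''.src : ℝ))))
    {B₀ ρ : ℝ} (hB₀ : 0 ≤ B₀) (hρ : 0 < ρ)
    (h0 : ∀ y'' y : PBond (F.P K) k, entry0 F N K k Ω U₀ levB T y'' y ≤ B₀ * Real.exp (-(ρ * (Site.tdist y''.src y.src : ℝ))))
    (h1 : ∀ y'' y : PBond (F.P K) k, entry1 F N K k Ω U₀ levB T y'' y ≤ B₀ * Real.exp (-(ρ * (Site.tdist y''.src y.src : ℝ)))) :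
    (∀ (b' : Bond (F.P K).d (fun _ => (F.P K).sitesPerDir 0)) (y : PBond (F.P K) k), 0 ≤ ‖nColOp F N K k Ω U₀ levB T S y b'‖) ∧
    (∀ (y : PBond (F.P K) k) (Z : Matrix (Fin N) (Fin N) ℂ) (b' : Bond (F.P K).d (fun _ => (F.P K).sitesPerDir 0)),
      ‖NegSup.equiv (levWeight (F.L : ℝ) ((F.P K).eta k) (bondLevLit F Ω k) 3) (Matrix (Fin N) (Fin N) ℂ) (S (T ((NegSup.equiv (levWeight (F.L : ℝ) ((F.P K).eta k) levB 0) (Matrix (Fin N) (Fin N) ℂ)).symm (Pi.single y Z)))) b'‖ ≤ ‖nColOp F N K k Ω U₀ levB T S y b'‖ * ‖Z‖) ∧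
    (0 ≤ ((((F.P K).L ^ (F.P K).d) ^ k : ℕ) : ℝ) * ((Cπ * B₀ * ((F.P K).d * (2 * (1 + 1 / (min σ ρ / 2))) ^ (F.P K).d)) * ((F.P K).d * (2 * (1 + 1 / (min σ ρ / 2))) ^ (F.P K).d))) ∧
    (∀ (bb : Bond (F.P K).d (fun _ => (F.P K).sitesPerDir 0)) (y : PBond (F.P K) k), ∑ b' : Bond (F.P K).d (fun _ => (F.P K).sitesPerDir 0),
        levWeight (F.L : ℝ) ((F.P K).eta k) (bondLevLit F Ω k) 3 bb / levWeight (F.L : ℝ) ((F.P K).eta k) (bondLevLit F Ω k) 1 b' * ‖nColOp F N K k Ω U₀ levB T S y b'‖ ≤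
      ((((F.P K).L ^ (F.P K).d) ^ k : ℕ) : ℝ) * ((Cπ * B₀ * ((F.P K).d * (2 * (1 + 1 / (min σ ρ / 2))) ^ (F.P K).d)) * ((F.P K).d * (2 * (1 + 1 / (min σ ρ / 2))) ^ (F.P K).d))) ∧
    (0 ≤ (Cπ * B₀ * ((F.P K).d * (2 * (1 + 1 / (min σ ρ / 2))) ^ (F.P K).d)) * ((F.P K).d * (2 * (1 + 1 / (min σ ρ / 2))) ^ (F.P K).d)) ∧
    (∀ b' : Bond (F.P K).d (fun _ => (F.P K).sitesPerDir 0), ∑ y : PBond (F.P K) k,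
        levWeight (F.L : ℝ) ((F.P K).eta k) (bondLevLit F Ω k) 3 b' / levWeight (F.L : ℝ) ((F.P K).eta k) levB 0 y * ‖nColOp F N K k Ω U₀ levB T S y b'‖ ≤
      (Cπ * B₀ * ((F.P K).d * (2 * (1 + 1 / (min σ ρ / 2))) ^ (F.P K).d)) * ((F.P K).d * (2 * (1 + 1 / (min σ ρ / 2))) ^ (F.P K).d)) :=
  klN_of_nEntryBounds F N K k Ω U₀ levB T S hΩ hk (mul_nonneg (mul_nonneg hCπ hB₀) (by positivity)) (by positivity)
    (nEntry0_le_of_localityRows F N K k Ω U₀ levB T S hs0 hs1 hS hCπ hσ hR hB₀ hρ h0 h1)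

/-! ## §4 ★★★ The ᵖʳ pin instance: `T := H₁^{pr}(U₀)` at a frame datum `𝔥`, `S := Δπ(U₀; G′, Q′)` -/

/-- ★★★ **{5} (KL-N)ᵖʳ AT THE PINS ⇐ {W2} ∧ {W3}** — §3 at `T := H1prOfRecordAtBg F N K k Ω U₀ 𝔥 levB a hpos hQ` (def-Y's framed `H₁^{pr}(U₀)` at ANY frame datum `𝔥`: the SL pin
`hierFrameDatumOfRecord`, the GL pin `hierFrameGLDatumOfRecord`; `hpos`, `hQ` DISPLAYED verbatim) and `S := DeltaPiCurOfRecord F N K k Ω U₀ Gp (QprimeOfRecord F N k U₀)` (the W₇ current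
reader of (80)∕(87)): the conclusions are LITERALLY the six (KL-N)ᵖʳ binders `hk'0 ∕ hNk ∕ hΘ'0 ∕ hΘ' ∕ hN₁0 ∕ hN₁` of ✓`prop4UniformPrAtRecord_node00_of_prop5Clause_hierFrame{,GL}Rec`
(✓`…KLCPrAtHierFrameParam` §2∕§3) at `hk′ := ‖nColOp Δπ H₁^{pr} y b′‖`.  {W2} = the (3.133) rows of `H₁^{pr}(U₀)` ([B9] Thm 3.12, XL, lane N07), {W3} = the locality rows of
`Δπ(U₀; G′, Q′)` ([15] (72)–(73)∕(86)–(89): `Δ_π = Δ_U + DRD*`, `R`'s (73) decay; L) — BOTH displayed, inhabited NOWHERE. [cite: Balaban1985Variational, (87)–(89) p.291, (72)–(73) p.289, (80) p.290, (103) p.293; Balaban1985BackgroundPropagators, Thm 3.12 (3.133) p.422] -/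
theorem klNPr_of_localityRows_of_entryBounds [NeZero N] [Fact (0 < c0Rec F K k)] [Fact (∀ c, 0 < wBRec F K k c)] (𝔥 : FrameDatum (F.P K) N k U₀) (a : ℝ)
    (hpos : ∀ x, x ≠ 0 → 0 < RCLike.re ⟪x, laplaceAOfRecord F N k U₀ (QprOfRecord F N k U₀ 𝔥) (QprimeOfRecord F N k U₀) a x⟫_ℂ)
    (hQ : Function.Surjective (QprOfRecord F N k U₀ 𝔥))
    (Gp : SiteL2K ℂ (F.P K).d (fun _ => (F.P K).sitesPerDir 0) (c0Rec F K k) (WRec N) →ₗ[ℂ]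
      SiteL2K ℂ (F.P K).d (fun _ => (F.P K).sitesPerDir 0) (c0Rec F K k) (WRec N))
    (hΩ : ∀ x, x ∈ Ω k) (hk : k ≤ (F.P K).m + (F.P K).K)
    {s0 : Bond (F.P K).d (fun _ => (F.P K).sitesPerDir 0) → Bond (F.P K).d (fun _ => (F.P K).sitesPerDir 0) → ℝ} {s1 : Bond (F.P K).d (fun _ => (F.P K).sitesPerDir 0) → Bond (F.P K).d (fun _ => (F.P K).sitesPerDir 0) × Fin (F.P K).d → ℝ} (hs0 : ∀ b' x, 0 ≤ s0 b' x) (hs1 : ∀ b' p, 0 ≤ s1 b' p)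
    (hS : ∀ (A : Space115Lit F N K k Ω U₀) (b' : Bond (F.P K).d (fun _ => (F.P K).sitesPerDir 0)),
      ‖NegSup.equiv (levWeight (F.L : ℝ) ((F.P K).eta k) (bondLevLit F Ω k) 3) (Matrix (Fin N) (Fin N) ℂ) (DeltaPiCurOfRecord F N K k Ω U₀ Gp (QprimeOfRecord F N k U₀) A) b'‖ ≤
        ∑ x : Bond (F.P K).d (fun _ => (F.P K).sitesPerDir 0), s0 b' x * ‖JetSup.equiv _ _ _ A x‖ +
        ∑ p : Bond (F.P K).d (fun _ => (F.P K).sitesPerDir 0) × Fin (F.P K).d, s1 b' p * ‖(nabla115 ((F.P K).eta k) (unitsOfRecord F N U₀)) (JetSup.equiv _ _ _ A) p‖)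
    {Cπ σ : ℝ} (hCπ : 0 ≤ Cπ) (hσ : 0 < σ)
    (hR : ∀ (b' : Bond (F.P K).d (fun _ => (F.P K).sitesPerDir 0)) (y'' : PBond (F.P K) k),
      blockRow0 F K k s0 b' y'' + blockRow1 F K k s1 b' y'' ≤
        Cπ * Real.exp (-(σ * (Site.tdist (blkOfBond F K k b').src y''.src : ℝ))))
    {B₀ ρ : ℝ} (hB₀ : 0 ≤ B₀) (hρ : 0 < ρ)
    (h0 : ∀ y'' y : PBond (F.P K) k, entry0 F N K k Ω U₀ levB (H1prOfRecordAtBg F N K k Ω U₀ 𝔥 levB a hpos hQ) y'' y ≤ B₀ * Real.exp (-(ρ * (Site.tdist y''.src y.src : ℝ))))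
    (h1 : ∀ y'' y : PBond (F.P K) k, entry1 F N K k Ω U₀ levB (H1prOfRecordAtBg F N K k Ω U₀ 𝔥 levB a hpos hQ) y'' y ≤ B₀ * Real.exp (-(ρ * (Site.tdist y''.src y.src : ℝ)))) :
    (∀ (b' : Bond (F.P K).d (fun _ => (F.P K).sitesPerDir 0)) (y : PBond (F.P K) k), 0 ≤ ‖nColOp F N K k Ω U₀ levB (H1prOfRecordAtBg F N K k Ω U₀ 𝔥 levB a hpos hQ) (DeltaPiCurOfRecord F N K k Ω U₀ Gp (QprimeOfRecord F N k U₀)) y b'‖) ∧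
    (∀ (y : PBond (F.P K) k) (Z : Matrix (Fin N) (Fin N) ℂ) (b' : Bond (F.P K).d (fun _ => (F.P K).sitesPerDir 0)),
      ‖NegSup.equiv (levWeight (F.L : ℝ) ((F.P K).eta k) (bondLevLit F Ω k) 3) (Matrix (Fin N) (Fin N) ℂ) (DeltaPiCurOfRecord F N K k Ω U₀ Gp (QprimeOfRecord F N k U₀) (H1prOfRecordAtBg F N K k Ω U₀ 𝔥 levB a hpos hQ ((NegSup.equiv (levWeight (F.L : ℝ) ((F.P K).eta k) levB 0) (Matrix (Fin N) (Fin N) ℂ)).symm (Pi.single y Z)))) b'‖ ≤ ‖nColOp F N K k Ω U₀ levB (H1prOfRecordAtBg F N K k Ω U₀ 𝔥 levB a hpos hQ) (DeltaPiCurOfRecord F N K k Ω U₀ Gp (QprimeOfRecord F N k U₀)) y b'‖ * ‖Z‖) ∧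
    (0 ≤ ((((F.P K).L ^ (F.P K).d) ^ k : ℕ) : ℝ) * ((Cπ * B₀ * ((F.P K).d * (2 * (1 + 1 / (min σ ρ / 2))) ^ (F.P K).d)) * ((F.P K).d * (2 * (1 + 1 / (min σ ρ / 2))) ^ (F.P K).d))) ∧
    (∀ (bb : Bond (F.P K).d (fun _ => (F.P K).sitesPerDir 0)) (y : PBond (F.P K) k), ∑ b' : Bond (F.P K).d (fun _ => (F.P K).sitesPerDir 0),
        levWeight (F.L : ℝ) ((F.P K).eta k) (bondLevLit F Ω k) 3 bb / levWeight (F.L : ℝ) ((F.P K).eta k) (bondLevLit F Ω k) 1 b' * ‖nColOp F N K k Ω U₀ levB (H1prOfRecordAtBg F N K k Ω U₀ 𝔥 levB a hpos hQ) (DeltaPiCurOfRecord F N K k Ω U₀ Gp (QprimeOfRecord F N k U₀)) y b'‖ ≤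
      ((((F.P K).L ^ (F.P K).d) ^ k : ℕ) : ℝ) * ((Cπ * B₀ * ((F.P K).d * (2 * (1 + 1 / (min σ ρ / 2))) ^ (F.P K).d)) * ((F.P K).d * (2 * (1 + 1 / (min σ ρ / 2))) ^ (F.P K).d))) ∧
    (0 ≤ (Cπ * B₀ * ((F.P K).d * (2 * (1 + 1 / (min σ ρ / 2))) ^ (F.P K).d)) * ((F.P K).d * (2 * (1 + 1 / (min σ ρ / 2))) ^ (F.P K).d)) ∧
    (∀ b' : Bond (F.P K).d (fun _ => (F.P K).sitesPerDir 0), ∑ y : PBond (F.P K) k,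
        levWeight (F.L : ℝ) ((F.P K).eta k) (bondLevLit F Ω k) 3 b' / levWeight (F.L : ℝ) ((F.P K).eta k) levB 0 y * ‖nColOp F N K k Ω U₀ levB (H1prOfRecordAtBg F N K k Ω U₀ 𝔥 levB a hpos hQ) (DeltaPiCurOfRecord F N K k Ω U₀ Gp (QprimeOfRecord F N k U₀)) y b'‖ ≤
      (Cπ * B₀ * ((F.P K).d * (2 * (1 + 1 / (min σ ρ / 2))) ^ (F.P K).d)) * ((F.P K).d * (2 * (1 + 1 / (min σ ρ / 2))) ^ (F.P K).d)) :=
  klN_of_localityRows_of_entryBounds F N K k Ω U₀ levB (H1prOfRecordAtBg F N K k Ω U₀ 𝔥 levB a hpos hQ) (DeltaPiCurOfRecord F N K k Ω U₀ Gp (QprimeOfRecord F N k U₀))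
    hΩ hk hs0 hs1 hS hCπ hσ hR hB₀ hρ h0 h1

end Summit.QuantumFields.YangMills.BalabanUVNodes.N07KLNOfLocalityRows
end
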